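/-
Copyright (c) 2026. All rights reserved.
Released under Apache 2.0 license as described in the file LICENSE.
-/
import Mathlib
import HarnessLib
import Literature.MathematicalPhysics.QuantumLattice.GaugeGroups
import Literature.MathematicalPhysics.QuantumFieldTheory.ConstructiveQFTWave0
import Literature.MathematicalPhysics.QuantumFieldTheory.LatticeGaugeProofs
import Literature.MathematicalPhysics.QuantumFieldTheory.U1GinibreComparison
import Literature.MathematicalPhysics.QuantumLattice.AbelianFieldTensor
import Literature.MathematicalPhysics.QuantumLattice.AbelianMagneticFlux
import Summits.Ventures.LatticeQCDFlow.Exactness.SymmetricMetropolis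
import Summits.Ventures.LatticeQCDFlow.Exactness.CompactHaar
import Summits.Ventures.LatticeQCDFlow.Scaling.LatticePeeling
import Summits.Ventures.LatticeQCDFlow.Scaling.SliceTwistWitness
import Summits.Ventures.LatticeQCDFlow.Scaling.FluxTunnellingU1Explicit
import Summits.Ventures.LatticeQCDFlow.Scaling.BoxSpreadWitness
import Summits.Ventures.LatticeQCDFlow.Scaling.BoxTouch
import Summits.Ventures.LatticeQCDFlow.Scaling.FluxTunnellingU1MaxPlaquette
import Summits.Ventures.LatticeQCDFlow.Scaling.FluxInsertionKernel
import Summits.Ventures.LatticeQCDFlow.Scaling.FluxInsertionBox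
import Summits.Ventures.LatticeQCDFlow.Scaling.ConvolutionPowerCompensation
import Summits.Ventures.LatticeQCDFlow.Scaling.FluxInsertionSharpFloor
import Summits.Ventures.LatticeQCDFlow.Scaling.FluxInsertionSharpFloorInstances
import Summits.Ventures.LatticeQCDFlow.Scaling.FluxInsertionSharpRate
import Literature.MathematicalPhysics.QuantumFieldTheory.TorusFreeTransfer
import Summits.Ventures.LatticeQCDFlow.Scaling.FluxInsertionHeightIdentity

import Summits.Ventures.LatticeQCDFlow.Scaling.FluxInsertionHeightLaw
import Summits.Ventures.LatticeQCDFlow.Scaling.TorusPotential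

/-!
# The sharp CEILING on the min–max height of the block insertion (item 107b)

HONEST FRAMING: exact (Metropolis-corrected) sampling algorithms for lattice gauge theory;
figures of merit are autocorrelation/cost numbers at stated couplings and volumes; no
continuum-physics claim.

Venture `LatticeQCDFlow` (cell pub-lqcd), topic `Scaling`, FANOUT row 29 (theory2, gen-20), item 107b
(imports items 106b, 107a).  NEW WORK; nothing here is cited as a fact.  Notation of items 106a/b:
Haar = product Haar probability measure (`u1Haar`), `S` = Wilson action, `Q = Flux.topCharge`,
`H_X = insHeight X` = `ess inf_{Haar | Q(XU) ≠ Q(U)} max(S(U), S(XU))`, `E(l,L) = boxHeight l L`,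
`N = (l+1)² − 4`, `M = L² − N`, `α_l = boxAlpha l = 2π/N`.

* §1 `essHeight_le_of_measure_pos`: a sublevel set of positive restricted measure bounds the
  essential height from above.
* §2 `continuousAt_topCharge`: Lüscher's charge is continuous at every configuration none of whose
  plaquettes (in the plane) equals `−1` (the principal argument is continuous off the cut).
* §3 `insHeight_le_of_witness`: ONE configuration `U₀` with `Q(XU₀) ≠ Q(U₀)` and no plaquette of
  `U₀`, `XU₀` on the cut gives `H_X ≤ max(S(U₀), S(XU₀))` — by continuity the crossing persists on
  a neighbourhood, which has positive Haar measure.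
* §4 the half-way configuration `halfWay l = potField (halfF l L)` of item 107a: charges `0 ↦ 1`
  under the block spread, both actions `= N(1 − cos(α_l/2)) + M(1 − cos(π/M))`; hence the
  **sharp ceiling** `E(l,L) ≤ N(1 − cos(π/N)) + M(1 − cos(π/M))` (`boxHeight_le_halfWay`), which
  improves item 106b's `boxHeight_le` (`π/(M−1)` there) to the conjectured value: THEORY-2.md §4
  C9″b is now EQUIVALENT to the single lower bound `E(l,L) ≥ N(1 − cos(π/N)) + M(1 − cos(π/M))`
  (a finite-dimensional mountain-pass statement), and for even `L` the height is bracketed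
  `N(1 − cos(π/N)) ≤ E(l,L) ≤ N(1 − cos(π/N)) + M(1 − cos(π/M))` (`boxHeight_bracket`).
-/

noncomputable section

open MeasureTheory Filter Topology Real
open scoped ENNReal
open Literature.MathematicalPhysics.QuantumFieldTheory Literature.MathematicalPhysics.QuantumLattice
open Summit.Ventures.LatticeQCDFlow.Exactness

namespace Summit.Ventures.LatticeQCDFlow.Theory2.Lattice.Flux

/-! ## §1 Sublevel sets of positive measure bound the essential height -/

section EssHeight

variable {α : Type*} [MeasurableSpace α]

/-- If `{f ≤ c}` has positive `ν|_A`-measure then `essHeight ν A f ≤ c`. [folklore] -/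
theorem essHeight_le_of_measure_pos {ν : Measure α} {A : Set α} {f : α → ℝ} {c : ℝ}
    (h : 0 < (ν.restrict A) {U | f U ≤ c}) : essHeight ν A f ≤ ENNReal.ofReal c := by
  by_contra hlt
  have hlt' : ENNReal.ofReal c < essHeight ν A f := not_le.mp hlt
  refine h.ne' (measure_mono_null (fun U hU => ?_) (ae_iff.mp (ae_essHeight_le ν A f)))
  simp only [Set.mem_setOf_eq] at hU ⊢
  exact fun hle => lt_irrefl _ ((hlt'.trans_le hle).trans_le (ENNReal.ofReal_le_ofReal hU))

end EssHeight

/-! ## §2 Continuity of the charge off the cut -/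

section Continuity

variable {d L : ℕ} [NeZero L]

omit [NeZero L] in
/-- `e^{iφ}` lies in the slit plane for `|φ| < π`. [folklore] -/
theorem coe_circleExp_mem_slitPlane {φ : ℝ} (h₁ : -π < φ) (h₂ : φ < π) :
    ((Circle.exp φ : Circle) : ℂ) ∈ Complex.slitPlane :=
  Complex.mem_slitPlane_iff_arg.mpr ⟨by rw [Circle.arg_exp h₁ h₂.le]; exact h₂.ne, Circle.coe_ne_zero _⟩

/-- **Lüscher's charge is continuous at every configuration whose plaquettes (in the plane) avoid
`−1`.** [folklore] -/
theorem continuousAt_topCharge (x₀ : Site d L) (μ' ν' : Fin d) {U₀ : GaugeConfig d L Circle}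
    (h : ∀ x, ((plaquetteHolonomy U₀ x μ' ν' : Circle) : ℂ) ∈ Complex.slitPlane) :
    ContinuousAt (topCharge x₀ μ' ν') U₀ := by
  have hF : ∀ x, ContinuousAt (fun U : GaugeConfig d L Circle => abelianFieldTensor U x μ' ν') U₀ := by
    intro x
    have hc : Continuous fun U : GaugeConfig d L Circle =>
        ((plaquetteHolonomy U x μ' ν' : Circle) : ℂ) :=
      continuous_subtype_val.comp (by unfold plaquetteHolonomy; fun_prop)
    show ContinuousAt (fun U : GaugeConfig d L Circle =>
      Complex.arg ((plaquetteHolonomy U x μ' ν' : Circle) : ℂ)) U₀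
    exact ContinuousAt.comp' (f := fun U : GaugeConfig d L Circle =>
      ((plaquetteHolonomy U x μ' ν' : Circle) : ℂ)) (Complex.continuousAt_arg (h x)) hc.continuousAt
  have hsum : ContinuousAt (fun U : GaugeConfig d L Circle => magneticFlux U x₀ μ' ν') U₀ := by
    unfold magneticFlux
    exact tendsto_finsetSum _ fun s _ => tendsto_finsetSum _ fun t _ => hF _
  unfold topCharge
  exact hsum.div_const _

end Continuity

/-! ## §3 One good crossing bounds the height -/

section Witness

variable {d L : ℕ} [NeZero L]

/-- **Height from a witness.** If `Q(XU₀) ≠ Q(U₀)` and no plaquette of `U₀` or `XU₀` (in the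
plane) equals `−1`, then `H_X ≤ max(S(U₀), S(XU₀))`: the charge difference is continuous at `U₀`,
so the crossing together with `max(S, S∘X) < max(S(U₀), S(XU₀)) + ε` holds on a neighbourhood of
`U₀`, which has positive Haar measure. [folklore] -/
theorem insHeight_le_of_witness (X U₀ : GaugeConfig d L Circle) (x₀ : Site d L) (μ' ν' : Fin d)
    (hU : ∀ x, ((plaquetteHolonomy U₀ x μ' ν' : Circle) : ℂ) ∈ Complex.slitPlane)
    (hXU : ∀ x, ((plaquetteHolonomy (X * U₀) x μ' ν' : Circle) : ℂ) ∈ Complex.slitPlane)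
    (hne : topCharge x₀ μ' ν' (X * U₀) ≠ topCharge x₀ μ' ν' U₀) :
    insHeight X x₀ μ' ν' ≤
      ENNReal.ofReal (max (wilsonAction u1Rep U₀) (wilsonAction u1Rep (X * U₀))) := by
  set f : GaugeConfig d L Circle → ℝ :=
    fun U => max (wilsonAction u1Rep U) (wilsonAction u1Rep (X * U)) with hf
  have hfc : Continuous f :=
    (continuous_wilsonAction u1Rep continuous_u1Rep).max
      ((continuous_wilsonAction u1Rep continuous_u1Rep).comp (continuous_const.mul continuous_id))
  have hf0 : 0 ≤ f U₀ := le_max_of_le_left (wilsonAction_u1_nonneg U₀)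
  have hg : ContinuousAt
      (fun U : GaugeConfig d L Circle => topCharge x₀ μ' ν' (X * U) - topCharge x₀ μ' ν' U) U₀ :=
    ((continuousAt_topCharge x₀ μ' ν' hXU).comp
        (continuous_const.mul continuous_id).continuousAt).sub
      (continuousAt_topCharge x₀ μ' ν' hU)
  refine ENNReal.le_of_forall_pos_le_add fun ε hε _ => ?_
  have hε' : (0 : ℝ) < ε := by exact_mod_cast hε
  have hN : {U : GaugeConfig d L Circle |
      topCharge x₀ μ' ν' (X * U) - topCharge x₀ μ' ν' U ≠ 0 ∧ f U < f U₀ + ε} ∈ 𝓝 U₀ :=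
    (hg.eventually_ne (sub_ne_zero.mpr hne)).and
      (hfc.continuousAt.eventually_lt continuousAt_const (by linarith))
  have hpos := Measure.measure_pos_of_mem_nhds (u1Haar d L) hN
  have hle : (u1Haar d L) {U : GaugeConfig d L Circle |
        topCharge x₀ μ' ν' (X * U) - topCharge x₀ μ' ν' U ≠ 0 ∧ f U < f U₀ + ε} ≤
      ((u1Haar d L).restrict {U | topCharge x₀ μ' ν' (X * U) ≠ topCharge x₀ μ' ν' U})
        {U | f U ≤ f U₀ + ε} := by
    rw [Measure.restrict_apply (measurableSet_le hfc.measurable measurable_const)]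
    exact measure_mono fun U hU => ⟨hU.2.le, sub_ne_zero.mp hU.1⟩
  calc insHeight X x₀ μ' ν' ≤ ENNReal.ofReal (f U₀ + ε) :=
        essHeight_le_of_measure_pos (hpos.trans_le hle)
    _ = ENNReal.ofReal (f U₀) + ε := by
        rw [ENNReal.ofReal_add hf0 hε'.le, ENNReal.ofReal_coe_nnreal]

end Witness

/-! ## §4 The half-way configuration and the sharp ceiling -/

section HalfWayConfig

variable {l L : ℕ} [NeZero L]

variable (l) in
/-- The HALF-WAY CONFIGURATION of the block insertion. [folklore] -/
def halfWay : GaugeConfig 2 L Circle := potField (halfF l L)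

omit [NeZero L] in
/-- Plaquettes of the half-way configuration: `e^{−iα_l/2}` on `R`, `e^{iπ/M}` off `R`.
[folklore] -/
theorem plaquetteHolonomy_halfWay (hl : 2 ≤ l) (hlL : l + 1 ≤ L) (x : Site 2 L) :
    plaquetteHolonomy (halfWay l : GaugeConfig 2 L Circle) x 0 1 =
      Circle.exp (halfF l L (x 0).val (x 1).val) :=
  plaquetteHolonomy_potField (by omega) (sum_halfF hl hlL) x

/-- Plaquettes after the insertion: `e^{+iα_l/2}` on `R`, `e^{iπ/M}` off `R`. [folklore] -/
theorem plaquetteHolonomy_boxSpread_mul_halfWay (hl : 2 ≤ l) (hlL : l + 1 ≤ L) (x : Site 2 L) :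
    plaquetteHolonomy (boxSpread l * halfWay l : GaugeConfig 2 L Circle) x 0 1 =
      Circle.exp (boxF l (x 0).val (x 1).val + halfF l L (x 0).val (x 1).val) := by
  rw [plaquetteHolonomy_mul', plaquetteHolonomy_boxSpread hl hlL, plaquetteHolonomy_halfWay hl hlL,
    Circle.exp_add]

omit [NeZero L] in
/-- Field tensor of the half-way configuration. [folklore] -/
theorem abelianFieldTensor_halfWay (hl : 2 ≤ l) (hlL : l + 1 ≤ L) (x : Site 2 L) :
    abelianFieldTensor (halfWay l : GaugeConfig 2 L Circle) x 0 1 = halfF l L (x 0).val (x 1).val := by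
  obtain ⟨h1, h2⟩ := halfF_bounds hl hlL (x 0).val (x 1).val
  exact abelianFieldTensor_eq_of_plaquette_eq_exp (plaquetteHolonomy_halfWay hl hlL x)
    (by linarith [Real.pi_pos]) (by linarith [Real.pi_pos])

/-- Field tensor after the insertion. [folklore] -/
theorem abelianFieldTensor_boxSpread_mul_halfWay (hl : 2 ≤ l) (hlL : l + 1 ≤ L) (x : Site 2 L) :
    abelianFieldTensor (boxSpread l * halfWay l : GaugeConfig 2 L Circle) x 0 1 =
      boxF l (x 0).val (x 1).val + halfF l L (x 0).val (x 1).val := by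
  obtain ⟨h1, h2⟩ := boxF_add_halfF_bounds hl hlL (x 0).val (x 1).val
  exact abelianFieldTensor_eq_of_plaquette_eq_exp (plaquetteHolonomy_boxSpread_mul_halfWay hl hlL x)
    (by linarith [Real.pi_pos]) (by linarith [Real.pi_pos])

/-- **The half-way configuration is in sector `0`.** [folklore] -/
theorem topCharge_halfWay (hl : 2 ≤ l) (hlL : l + 1 ≤ L) :
    topCharge (0 : Site 2 L) 0 1 (halfWay l) = 0 := by
  rw [topCharge_of_fieldTensor (abelianFieldTensor_halfWay hl hlL), sum_halfF hl hlL, zero_div]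

/-- **The insertion moves the half-way configuration to sector `1`.** [folklore] -/
theorem topCharge_boxSpread_mul_halfWay (hl : 2 ≤ l) (hlL : l + 1 ≤ L) :
    topCharge (0 : Site 2 L) 0 1 (boxSpread l * halfWay l) = 1 := by
  rw [topCharge_of_fieldTensor (g := fun a b => boxF l a b + halfF l L a b)
    (abelianFieldTensor_boxSpread_mul_halfWay hl hlL)]
  simp only [Finset.sum_add_distrib]
  rw [sum_boxF hl hlL, sum_halfF hl hlL, add_zero]
  field_simp

/-- **Action of the half-way configuration**: `N(1 − cos(α_l/2)) + M(1 − cos(π/M))`. [folklore] -/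
theorem wilsonAction_halfWay (hl : 2 ≤ l) (hlL : l + 1 ≤ L) :
    wilsonAction u1Rep (halfWay l : GaugeConfig 2 L Circle) =
      (((l + 1) * (l + 1) - 4 : ℕ) : ℝ) * (1 - Real.cos (boxAlpha l / 2)) +
        ((L ^ 2 - ((l + 1) * (l + 1) - 4) : ℕ) : ℝ) *
          (1 - Real.cos (π / ((L ^ 2 - ((l + 1) * (l + 1) - 4) : ℕ) : ℝ))) := by
  rw [wilsonAction_of_plaquette_exp (plaquetteHolonomy_halfWay hl hlL)]
  simp only [one_sub_cos_halfF hl]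
  rw [sum_boxF_affine hl hlL, halfWay_action_value hl hlL]

/-- **Action after the insertion**: the same value. [folklore] -/
theorem wilsonAction_boxSpread_mul_halfWay (hl : 2 ≤ l) (hlL : l + 1 ≤ L) :
    wilsonAction u1Rep (boxSpread l * halfWay l : GaugeConfig 2 L Circle) =
      (((l + 1) * (l + 1) - 4 : ℕ) : ℝ) * (1 - Real.cos (boxAlpha l / 2)) +
        ((L ^ 2 - ((l + 1) * (l + 1) - 4) : ℕ) : ℝ) *
          (1 - Real.cos (π / ((L ^ 2 - ((l + 1) * (l + 1) - 4) : ℕ) : ℝ))) := by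
  rw [wilsonAction_of_plaquette_exp (g := fun a b => boxF l a b + halfF l L a b)
    (plaquetteHolonomy_boxSpread_mul_halfWay hl hlL)]
  simp only [one_sub_cos_boxF_add_halfF hl]
  rw [sum_boxF_affine hl hlL, halfWay_action_value hl hlL]

end HalfWayConfig

section Box

variable {l L : ℕ} [NeZero L]

/-- **THE SHARP CEILING ON THE MIN–MAX HEIGHT**:
`E(l,L) ≤ N(1 − cos(α_l/2)) + M(1 − cos(π/M))`, witnessed by the half-way configuration. [folklore] -/
theorem boxHeight_le_halfWay (hl : 2 ≤ l) (hlL : l + 1 ≤ L) :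
    boxHeight l L ≤ ENNReal.ofReal
      ((((l + 1) * (l + 1) - 4 : ℕ) : ℝ) * (1 - Real.cos (boxAlpha l / 2)) +
        ((L ^ 2 - ((l + 1) * (l + 1) - 4) : ℕ) : ℝ) *
          (1 - Real.cos (π / ((L ^ 2 - ((l + 1) * (l + 1) - 4) : ℕ) : ℝ)))) := by
  have hα := boxAlpha_pos hl
  have hαπ := boxAlpha_lt_pi hl
  have h1 := insHeight_le_of_witness (boxSpread (L := L) l) (halfWay l) (0 : Site 2 L) 0 1
    (fun x => by
      obtain ⟨h₁, h₂⟩ := halfF_bounds hl hlL (x 0).val (x 1).val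
      rw [plaquetteHolonomy_halfWay hl hlL]
      exact coe_circleExp_mem_slitPlane (by linarith [Real.pi_pos]) (by linarith [Real.pi_pos]))
    (fun x => by
      obtain ⟨h₁, h₂⟩ := boxF_add_halfF_bounds hl hlL (x 0).val (x 1).val
      rw [plaquetteHolonomy_boxSpread_mul_halfWay hl hlL]
      exact coe_circleExp_mem_slitPlane (by linarith [Real.pi_pos]) (by linarith [Real.pi_pos]))
    (by rw [topCharge_boxSpread_mul_halfWay hl hlL, topCharge_halfWay hl hlL]; exact one_ne_zero)
  rw [wilsonAction_halfWay hl hlL, wilsonAction_boxSpread_mul_halfWay hl hlL, max_self] at h1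
  exact (min_le_left _ _).trans h1

/-- The conjectured value is nonnegative. [folklore] -/
theorem halfWay_value_nonneg (l L : ℕ) :
    0 ≤ (((l + 1) * (l + 1) - 4 : ℕ) : ℝ) * (1 - Real.cos (boxAlpha l / 2)) +
        ((L ^ 2 - ((l + 1) * (l + 1) - 4) : ℕ) : ℝ) *
          (1 - Real.cos (π / ((L ^ 2 - ((l + 1) * (l + 1) - 4) : ℕ) : ℝ))) :=
  add_nonneg (mul_nonneg (Nat.cast_nonneg _) (sub_nonneg.mpr (Real.cos_le_one _)))
    (mul_nonneg (Nat.cast_nonneg _) (sub_nonneg.mpr (Real.cos_le_one _)))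

/-- **The sharp ceiling, real form**: `E(l,L) ≤ N(1 − cos(π/N)) + M(1 − cos(π/M))` — item 106b's
`boxHeight_le` with `π/(M−1)` improved to `π/M`, i.e. the conjectured value (THEORY-2.md §4 C9″b)
is an UPPER bound. [folklore] -/
theorem boxHeight_le_sharp (hl : 2 ≤ l) (hlL : l + 1 ≤ L) :
    (boxHeight l L).toReal ≤
      (((l + 1) * (l + 1) - 4 : ℕ) : ℝ) * (1 - Real.cos (boxAlpha l / 2)) +
        ((L ^ 2 - ((l + 1) * (l + 1) - 4) : ℕ) : ℝ) *
          (1 - Real.cos (π / ((L ^ 2 - ((l + 1) * (l + 1) - 4) : ℕ) : ℝ))) :=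
  ENNReal.toReal_le_of_le_ofReal (halfWay_value_nonneg l L) (boxHeight_le_halfWay hl hlL)

/-- **The bracket** (even `L`): `N(1 − cos(π/N)) ≤ E(l,L) ≤ N(1 − cos(π/N)) + M(1 − cos(π/M))`;
the fixed-volume conjecture C9″b is the statement that the upper end is attained. [folklore] -/
theorem boxHeight_bracket (hl : 2 ≤ l) (hlL : l + 1 ≤ L) (hLe : Even L) :
    (((l + 1) * (l + 1) - 4 : ℕ) : ℝ) * (1 - Real.cos (boxAlpha l / 2)) ≤ (boxHeight l L).toReal ∧
      (boxHeight l L).toReal ≤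
        (((l + 1) * (l + 1) - 4 : ℕ) : ℝ) * (1 - Real.cos (boxAlpha l / 2)) +
          ((L ^ 2 - ((l + 1) * (l + 1) - 4) : ℕ) : ℝ) *
            (1 - Real.cos (π / ((L ^ 2 - ((l + 1) * (l + 1) - 4) : ℕ) : ℝ))) :=
  ⟨boxHeight_ge hl hlL hLe, boxHeight_le_sharp hl hlL⟩

/-- **The tunnelling rate with the sharp ceiling**: for every `ε > 0`, eventually in `β`,
`boxTunnelProb β l L ≥ e^{−β (N(1 − cos(π/N)) + M(1 − cos(π/M)) + ε)}` — the fixed-volume floor of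
item 105 with `π/(M−1)` replaced by `π/M` and no polynomial prefactor bookkeeping. [folklore] -/
theorem u1_boxInsertion_rate_floor_sharp (hl : 2 ≤ l) (hlL : l + 1 ≤ L) {ε : ℝ} (hε : 0 < ε) :
    ∀ᶠ β : ℝ in atTop,
      Real.exp (-(β * ((((l + 1) * (l + 1) - 4 : ℕ) : ℝ) * (1 - Real.cos (boxAlpha l / 2)) +
          ((L ^ 2 - ((l + 1) * (l + 1) - 4) : ℕ) : ℝ) *
            (1 - Real.cos (π / ((L ^ 2 - ((l + 1) * (l + 1) - 4) : ℕ) : ℝ))) + ε))) ≤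
        boxTunnelProb β l L := by
  filter_upwards [u1_boxInsertion_height_law hl hlL hε, eventually_ge_atTop (0 : ℝ)] with β h hβ
  refine le_trans ?_ h.1
  apply Real.exp_le_exp.mpr
  have := boxHeight_le_sharp hl hlL
  nlinarith

end Box

end Summit.Ventures.LatticeQCDFlow.Theory2.Lattice.Flux

end
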